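import Summits.CriticalPhenomena.PercolationContinuityZ3.Theses.PercTorusSliceFilling

/-!
# Route PercTorusSliceFilling — glue item `CruxesGiveTarget`

The target `Target` of the thesis `PercTorusSliceFilling` is, verbatim, the conjunction of the two
cruxes `ThinClusterRarity` (TCR, box form of thin-cluster rarity on `ℤ³` at `p_c`) and
`NoCriticalTorusGiant` (no giant open cluster on the critical 3-torus). The support item
`CruxesGiveTarget : ThinClusterRarity → NoCriticalTorusGiant → Target` (item
stmt-CriticalPhenomena-14213) is therefore conjunction introduction; this file proves it with the
type stated literally as the route declaration.
-/

namespace Summit.CriticalPhenomena.PercolationContinuityZ3.Theorems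

open Summit.CriticalPhenomena.PercolationContinuityZ3.Theses.PercTorusSliceFilling

/-- Glue item `CruxesGiveTarget` of route `PercTorusSliceFilling` (stmt-CriticalPhenomena-14213):
the two cruxes `ThinClusterRarity` and `NoCriticalTorusGiant` together give the route target
`Target`, which is by definition their conjunction. Proof: unfold and pair the hypotheses. -/
theorem cruxesGiveTarget_proof :
    Summit.CriticalPhenomena.PercolationContinuityZ3.Theses.PercTorusSliceFilling.CruxesGiveTarget := by
  unfold CruxesGiveTarget Target ThinClusterRarity NoCriticalTorusGiant
  intro hTCR hNoGiant
  exact ⟨hTCR, hNoGiant⟩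

end Summit.CriticalPhenomena.PercolationContinuityZ3.Theorems
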